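import Summits.NavierStokesRegularity.NavierStokesRegularity.Theorems.RecurrentProfilesRecurrentLiouvillePrRecurrentHullSymmetric
import Summits.NavierStokesRegularity.NavierStokesRegularity.Theorems.SqueezeCycleRecurrentLiouvilleNearIdentityDSS
import Summits.NavierStokesRegularity.NavierStokesRegularity.Theorems.RecurrentProfilesRecurrentReductionOrbit
import HarnessLib

/-!
# Crux `RecurrentLiouville` (stmt-NavierStokesRegularity-1589), line `Sketch` (skeleton v9) — harvest
  stub `stub_prHullRateInvariant`: the Type-I constant is a hull invariant of recurrent profiles

Theorems-only support file (no definitions, no named facts).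

Write `Q(0, R) = ]-R², 0[ × B(0, R)` (`parabolicCylinder R 0`) for the backward parabolic ball at
the origin of `ℝ × ℝ³`, `u_c(t, x) = c u(c² t, c x)` (`nsRescale c u`) for the Navier–Stokes
rescaling, and "the rate bound `C'`" for the almost-everywhere Type-I bound
`‖u(t, x)‖ ≤ C'/√(−t)` on the open backward slab `(−∞, 0) × ℝ³` (KNSS 2009, (1.4)).

**Statement** (`stub_prHullRateInvariant`).  Let `u, v ∈ L³(Q(0, R))` for every `R > 0`, let
`λₙ > 0` with `u_{λₙ} → v` in every `L³(Q(0, R))`, and let `u` be uniformly recurrent under scaling.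
Then for every `C'`, `u` obeys the rate bound `C'` a.e. on the slab iff `v` does: the optimal
Type-I constant is constant on the `L³_loc` scaling hull of a uniformly recurrent field.

**Proof.**
* SCALE INVARIANCE (`prHR_ae_rate_nsRescale`).  The rate bound is invariant under `u ↦ u_c`,
  `c > 0`, as an a.e. statement: the parabolic dilation `(t, x) ↦ (c² t, c x)` is a non-singular
  affine map preserving the slab (`ae_restrict_preimage_stAffine`,
  `stAffine_sq_preimage_Iio_prod_univ`), and `c · C'/√(−c² t) = C'/√(−t)`.
* PASSAGE TO THE LIMIT (`prHR_ae_rate_of_limit`, KNSS 2009 (1.4) for limits).  On each ball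
  `Q(0, n+1)` the `L³` convergence `u_{λⱼ} → v` is convergence in measure, so a subsequence
  converges a.e.; intersecting with the countably many a.e. rate bounds of the `u_{λⱼ}` gives the
  rate bound for `v` a.e. on `Q(0, n+1)`, and the balls exhaust the slab.  This is direction `→`,
  and it uses no recurrence.
* HULL SYMMETRY (direction `←`).  By `stub_prRecurrentHullSymmetric` (Furstenberg 1981, Thm. 1.17 in
  the `L³_loc` model) `u` is in turn an `L³_loc` limit of rescalings `v_{μₖ}` of `v`
  (`prHR_exists_reverse_limit`: take `μₖ` with `‖v_{μₖ} − u‖_{L³(Q(0, k+1))} ≤ 1/(k+1)`), and the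
  previous step applies with the roles of `u` and `v` exchanged.

## References

* [folklore] — the statement; standard in the blow-up analysis of Type-I singularities.
* D. Albritton, T. Barker, *Global weak Besov solutions of the Navier–Stokes equations and
  applications*, J. Math. Fluid Mech. 21 (2019), no. 43 = arXiv:1811.00502, §3 (the `L³_loc`
  setting of rescaled solutions on the backward slab). [AlbrittonBarker2019]
* G. Koch, N. Nadirashvili, G. Seregin, V. Šverák, *Liouville theorems for the Navier–Stokes
  equations and applications*, Acta Math. 203 (2009), (1.4) (the Type-I rate
  `‖u(t,x)‖ ≤ C/√(−t)`). [KNSS2009]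
* H. Furstenberg, *Recurrence in Ergodic Theory and Combinatorial Number Theory* (1981), Ch. 1 §4,
  Thm. 1.17. [Furstenberg1981]
-/

noncomputable section

-- the sub-problem namespace repeats the summit name (D-0017 layout `Summit.<S>.<P>.Theorems`)
set_option linter.dupNamespace false

namespace Summit.NavierStokesRegularity.NavierStokesRegularity.Theorems

open MeasureTheory Set Function Filter Topology TopologicalSpace Metric
open Literature.Analysis Literature.Analysis.FluidPDE
open scoped NNReal ENNReal

/-! ### Scale invariance of the a.e. rate bound -/

/-- **The a.e. Type-I rate bound is scale invariant.**  If `‖u(t, x)‖ ≤ C'/√(−t)` for a.e.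
`(t, x)` in the open backward slab, then the same holds for the rescaled field
`u_c(t, x) = c u(c² t, c x)`, `c > 0`: transport along the slab-preserving parabolic dilation and
`c · C'/√(−c² t) = C'/√(−t)`. [folklore] -/
theorem prHR_ae_rate_nsRescale
    {u : ℝ → EuclideanSpace ℝ (Fin 3) → EuclideanSpace ℝ (Fin 3)} {c C' : ℝ} (hc : 0 < c)
    (h : ∀ᵐ z ∂(volume.restrict (Iio (0 : ℝ) ×ˢ (univ : Set (EuclideanSpace ℝ (Fin 3))))),
      ‖u z.1 z.2‖ ≤ C' / Real.sqrt (-z.1)) :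
    ∀ᵐ z ∂(volume.restrict (Iio (0 : ℝ) ×ˢ (univ : Set (EuclideanSpace ℝ (Fin 3))))),
      ‖nsRescale c u z.1 z.2‖ ≤ C' / Real.sqrt (-z.1) := by
  have hc2 : 0 < c ^ 2 := by positivity
  have hΦ := ae_restrict_preimage_stAffine hc2 hc 0 (0 : EuclideanSpace ℝ (Fin 3))
    (P := fun z : ℝ × EuclideanSpace ℝ (Fin 3) => ‖u z.1 z.2‖ ≤ C' / Real.sqrt (-z.1)) h
  rw [stAffine_sq_preimage_Iio_prod_univ hc.ne'] at hΦ
  filter_upwards [hΦ] with z hz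
  have hz' : ‖u (c ^ 2 * z.1) (c • z.2)‖ ≤ C' / Real.sqrt (-(c ^ 2 * z.1)) := by
    simpa only [stAffine_fst, stAffine_snd, zero_add] using hz
  have hsqrt : Real.sqrt (-(c ^ 2 * z.1)) = c * Real.sqrt (-z.1) := by
    rw [neg_mul_eq_mul_neg, Real.sqrt_mul (sq_nonneg c), Real.sqrt_sq hc.le]
  rw [hsqrt] at hz'
  rw [nsRescale_apply, norm_smul, Real.norm_eq_abs, abs_of_pos hc]
  calc c * ‖u (c ^ 2 * z.1) (c • z.2)‖
      ≤ c * (C' / (c * Real.sqrt (-z.1))) := mul_le_mul_of_nonneg_left hz' hc.le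
    _ = C' / Real.sqrt (-z.1) := by rw [← mul_div_assoc, mul_div_mul_left C' _ hc.ne']

/-! ### Passage to `L³_loc` limits -/

/-- **Rescalings of an `L³_loc` field are `L³_loc`** (measurability bookkeeping): if
`u ∈ L³(Q(0, R))` for every `R > 0`, then `u_c ∈ L³(Q(0, R))` for every `c > 0`, `R > 0`
(`u_c = c u ∘ Φ_c` and `Φ_c(Q(0, R)) = Q(0, c R)`). [folklore] -/
theorem prHR_memLp_nsRescale
    {u : ℝ → EuclideanSpace ℝ (Fin 3) → EuclideanSpace ℝ (Fin 3)}
    (hu : ∀ R : ℝ, 0 < R →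
      MemLp (uncurry u) 3 (volume.restrict (parabolicCylinder R (0 : ℝ × EuclideanSpace ℝ (Fin 3)))))
    {c : ℝ} (hc : 0 < c) {R : ℝ} (hR : 0 < R) :
    MemLp (uncurry (nsRescale c u)) 3
      (volume.restrict (parabolicCylinder R (0 : ℝ × EuclideanSpace ℝ (Fin 3)))) := by
  rw [nsRescale_eq_zoom]
  exact memLp_three_zoom hc (hu (c * R) (mul_pos hc hR))

/-- **A.e. rate bounds pass to `L³_loc` limits of rescalings** (direction `→` of the hull
invariance, no recurrence needed).  If `u, v ∈ L³(Q(0, R))` for all `R > 0`, `λₙ > 0`,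
`u_{λₙ} → v` in every `L³(Q(0, R))`, and `‖u(t, x)‖ ≤ C'/√(−t)` a.e. on the slab, then
`‖v(t, x)‖ ≤ C'/√(−t)` a.e. on the slab: each `u_{λⱼ}` obeys the bound a.e. (scale invariance), on
each ball `Q(0, n+1)` a subsequence converges a.e. (convergence in measure), and the balls exhaust
the slab. [cite: KNSS2009, (1.4)] -/
theorem prHR_ae_rate_of_limit
    (u v : ℝ → EuclideanSpace ℝ (Fin 3) → EuclideanSpace ℝ (Fin 3)) (lam : ℕ → ℝ)
    (hu : ∀ R : ℝ, 0 < R →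
      MemLp (uncurry u) 3 (volume.restrict (parabolicCylinder R (0 : ℝ × EuclideanSpace ℝ (Fin 3)))))
    (hv : ∀ R : ℝ, 0 < R →
      MemLp (uncurry v) 3 (volume.restrict (parabolicCylinder R (0 : ℝ × EuclideanSpace ℝ (Fin 3)))))
    (hlam : ∀ n, 0 < lam n)
    (hconv : ∀ R : ℝ, 0 < R → Tendsto (fun n => eLpNorm (uncurry (nsRescale (lam n) u) - uncurry v) 3
      (volume.restrict (parabolicCylinder R (0 : ℝ × EuclideanSpace ℝ (Fin 3))))) atTop (𝓝 0))
    {C' : ℝ}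
    (hrate : ∀ᵐ z ∂(volume.restrict (Iio (0 : ℝ) ×ˢ (univ : Set (EuclideanSpace ℝ (Fin 3))))),
      ‖u z.1 z.2‖ ≤ C' / Real.sqrt (-z.1)) :
    ∀ᵐ z ∂(volume.restrict (Iio (0 : ℝ) ×ˢ (univ : Set (EuclideanSpace ℝ (Fin 3))))),
      ‖v z.1 z.2‖ ≤ C' / Real.sqrt (-z.1) := by
  refine ae_restrict_of_ae_restrict_of_subset lowerHalf_subset_iUnion_parabolicCylinder ?_
  rw [ae_restrict_iUnion_iff]
  intro n
  have hn : (0 : ℝ) < (n : ℝ) + 1 := by positivity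
  -- `L³` convergence on the ball is convergence in measure: an a.e. convergent subsequence
  have hTIM : TendstoInMeasure
      (volume.restrict (parabolicCylinder ((n : ℝ) + 1) (0 : ℝ × EuclideanSpace ℝ (Fin 3))))
      (fun j => uncurry (nsRescale (lam j) u)) atTop (uncurry v) :=
    tendstoInMeasure_of_tendsto_eLpNorm (by norm_num)
      (fun j => (prHR_memLp_nsRescale hu (hlam j) hn).1) (hv _ hn).1 (hconv _ hn)
  obtain ⟨ns, -, hae⟩ := hTIM.exists_seq_tendsto_ae
  -- the countably many a.e. rate bounds of the rescalings, restricted to the ball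
  have hall : ∀ᵐ z ∂(volume.restrict
      (parabolicCylinder ((n : ℝ) + 1) (0 : ℝ × EuclideanSpace ℝ (Fin 3)))),
      ∀ j : ℕ, ‖nsRescale (lam j) u z.1 z.2‖ ≤ C' / Real.sqrt (-z.1) :=
    ae_all_iff.2 fun j =>
      ae_restrict_of_ae_restrict_of_subset (parabolicCylinder_origin_subset_slab _)
        (prHR_ae_rate_nsRescale (hlam j) hrate)
  filter_upwards [hae, hall] with z hz hz'
  exact le_of_tendsto hz.norm (Eventually.of_forall fun k => hz' (ns k))

/-! ### The reverse approximation supplied by hull symmetry -/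

/-- **A reverse approximating sequence.**  Under the hypotheses of the stub, hull symmetry
(`stub_prRecurrentHullSymmetric`) yields scales `μₖ > 0` with `v_{μₖ} → u` in every
`L³(Q(0, R))`: take `‖v_{μₖ} − u‖_{L³(Q(0, k+1))} ≤ 1/(k+1)` and use the monotonicity of the balls
in the radius. [cite: Furstenberg1981, Ch. 1 §4, Thm. 1.17] -/
theorem prHR_exists_reverse_limit
    (u v : ℝ → EuclideanSpace ℝ (Fin 3) → EuclideanSpace ℝ (Fin 3)) (lam : ℕ → ℝ)
    (hu : ∀ R : ℝ, 0 < R →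
      MemLp (uncurry u) 3 (volume.restrict (parabolicCylinder R (0 : ℝ × EuclideanSpace ℝ (Fin 3)))))
    (hv : ∀ R : ℝ, 0 < R →
      MemLp (uncurry v) 3 (volume.restrict (parabolicCylinder R (0 : ℝ × EuclideanSpace ℝ (Fin 3)))))
    (hlam : ∀ n, 0 < lam n)
    (hconv : ∀ R : ℝ, 0 < R → Tendsto (fun n => eLpNorm (uncurry (nsRescale (lam n) u) - uncurry v) 3
      (volume.restrict (parabolicCylinder R (0 : ℝ × EuclideanSpace ℝ (Fin 3))))) atTop (𝓝 0))
    (hrec : IsScalingUniformlyRecurrent u) :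
    ∃ μ : ℕ → ℝ, (∀ k, 0 < μ k) ∧
      ∀ R : ℝ, 0 < R → Tendsto (fun k => eLpNorm (uncurry (nsRescale (μ k) v) - uncurry u) 3
        (volume.restrict (parabolicCylinder R (0 : ℝ × EuclideanSpace ℝ (Fin 3))))) atTop (𝓝 0) := by
  have hsym := stub_prRecurrentHullSymmetric u v lam hu hv hlam hconv hrec
  choose μ hμ hμle using fun k : ℕ =>
    hsym (1 / ((k : ℝ) + 1)) (by positivity) ((k : ℝ) + 1) (by positivity)
  refine ⟨μ, hμ, fun R hR => ?_⟩
  obtain ⟨m, hm⟩ := exists_nat_ge R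
  have h0 : Tendsto (fun k : ℕ => ENNReal.ofReal (1 / ((k : ℝ) + 1))) atTop (𝓝 0) := by
    rw [← ENNReal.ofReal_zero]
    exact ENNReal.tendsto_ofReal tendsto_one_div_add_atTop_nhds_zero_nat
  refine tendsto_of_tendsto_of_tendsto_of_le_of_le' tendsto_const_nhds h0
    (Eventually.of_forall fun _ => zero_le) ?_
  filter_upwards [eventually_ge_atTop m] with k hk
  have hk' : (m : ℝ) ≤ k := Nat.cast_le.2 hk
  have hsub : parabolicCylinder R (0 : ℝ × EuclideanSpace ℝ (Fin 3)) ⊆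
      parabolicCylinder ((k : ℝ) + 1) (0 : ℝ × EuclideanSpace ℝ (Fin 3)) :=
    SuitableCompactness.parabolicCylinder_zero_mono hR.le (by linarith)
  exact (eLpNorm_mono_measure _ (Measure.restrict_mono hsub le_rfl)).trans (hμle k)

/-! ### The stub -/

/-- **T5 · THE TYPE-I CONSTANT IS A HULL INVARIANT.**  If `u` is uniformly recurrent under scaling
and `u_{λₙ} → v` in every `L³(Q(0,R))` (`u, v ∈ L³(Q(0, R))` for all `R > 0`, `λₙ > 0`), then `u`
and `v` obey exactly the same a.e. rate bounds `‖·(t,x)‖ ≤ C'/√(−t)` on the slab: `→` because rate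
bounds are scale invariant and pass to `L³_loc` limits a.e. (`prHR_ae_rate_of_limit`), `←` by
hull symmetry (`stub_prRecurrentHullSymmetric`: `u` is an `L³_loc` limit of rescalings of `v`,
`prHR_exists_reverse_limit`) and `→` with the roles exchanged. [folklore] -/
theorem stub_prHullRateInvariant :
    ∀ (u v : ℝ → EuclideanSpace ℝ (Fin 3) → EuclideanSpace ℝ (Fin 3)) (lam : ℕ → ℝ),
      (∀ R : ℝ, 0 < R → MemLp (uncurry u) 3 (volume.restrict (parabolicCylinder R (0 : ℝ × EuclideanSpace ℝ (Fin 3))))) →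
      (∀ R : ℝ, 0 < R → MemLp (uncurry v) 3 (volume.restrict (parabolicCylinder R (0 : ℝ × EuclideanSpace ℝ (Fin 3))))) →
      (∀ n, 0 < lam n) →
      (∀ R : ℝ, 0 < R → Tendsto (fun n => eLpNorm (uncurry (nsRescale (lam n) u) - uncurry v) 3
        (volume.restrict (parabolicCylinder R (0 : ℝ × EuclideanSpace ℝ (Fin 3))))) atTop (𝓝 0)) →
      IsScalingUniformlyRecurrent u →
      ∀ C' : ℝ, (∀ᵐ z ∂(volume.restrict (Iio (0 : ℝ) ×ˢ (univ : Set (EuclideanSpace ℝ (Fin 3))))), ‖u z.1 z.2‖ ≤ C' / Real.sqrt (-z.1)) ↔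
        (∀ᵐ z ∂(volume.restrict (Iio (0 : ℝ) ×ˢ (univ : Set (EuclideanSpace ℝ (Fin 3))))), ‖v z.1 z.2‖ ≤ C' / Real.sqrt (-z.1)) := by
  intro u v lam hu hv hlam hconv hrec C'
  obtain ⟨μ, hμ, hconv'⟩ := prHR_exists_reverse_limit u v lam hu hv hlam hconv hrec
  exact ⟨prHR_ae_rate_of_limit u v lam hu hv hlam hconv,
    prHR_ae_rate_of_limit v u μ hv hu hμ hconv'⟩

end Summit.NavierStokesRegularity.NavierStokesRegularity.Theorems
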